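import Literature.NumberTheory.EllipticCurves.SubgroupSelmer
import Literature.NumberTheory.EllipticCurves.GreenbergVatsal2000.GreenbergSelmerGroups
import Mathlib.GroupTheory.DoubleCoset
import Literature.NumberTheory.EllipticCurves.SelmerProofs
import Literature.NumberTheory.GaloisRepresentations.ContinuousH1
import HarnessLib

/-!
# Crux `PrintCf2.SplitBadTwoRankOneOfFacts` (stmt-BirchSwinnertonDyer-20368), skeleton v13.1, stub S3n′ `stub_pseudoNullFinite_two`,
# S3N-FACTFREE brick R2, file 5 (B3 of `Cruxes/…/R2-BRICKS-w5g7.md`): FINITE LEVELS ↔ THE DIVISIBLE MODULE in the line's currency —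
# classes killed by `N` come from the level `A[N]` when `A` is `N`-divisible, and both clauses of (SUR_U) transport along the
# inclusion of a level

Cell `bsd-print-cf2`, WIDTH seat `bsd-line-cf2-p1-w5` g7 (prover-bsd-line-cf2-p1-w5-g7-0); `--supports stmt-BirchSwinnertonDyer-20368`
(helper, Theses-free). HONEST FRAMING: nothing here closes the crux or a registered stub; BSD is not proved by any of this; no summit
statement is proved by this seat. No definition, no named fact, no `sorry`. Unconditional; pure continuous group cohomology in the
`discreteH1` / `resH1Hom` / `conjH1` currency of `SubgroupSelmer` and `GreenbergSelmerGroups` (no Poitou–Tate, no Shapiro).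

WHY. File 4 (`…LayerLocSurjOfDualPullback`, p702949) gives (SUR_U) for FINITE modules `M₀ → M` (the levels `A_θ[2^k] ↪ A_θ[2^m]`); the
consumer ((LS↑) → its LIMIT over the layers) wants it for the divisible `A_θ`. This file is the glue, for any topological group `G` and
any injective equivariant `ι : M₀ → A` onto the `N`-torsion of a discrete `A` with open stabilisers:
* §1 **`exists_resH1Hom_eq_of_nsmul_eq_zero`** — if `A` is `N`-divisible, every `x ∈ H¹(G, A)` with `N • x = 0` is `ι_* y` for some
  `y ∈ H¹(G, M₀)` (from `0 → A[N] → A →(N) A → 0`: `N φ = ∂a`, `a = N b`, `φ − ∂b` takes values in `A[N]`; the principal cocycle is the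
  tree's `exists_contOneCocycles_apply_eq_smul_sub`). USE: the finitely many targets `τ w q ∈ H¹(U ⊓ D_w, A_θ)` of (LS↑) descend to a
  level `k` (`G = decompIn U w`).
* §2 (number field `K`, `U ≤ Γ_K`, a place `w`, equivariant `ι : N → A'`): `resH1Hom_conjH1` (`ι_*` commutes with `conjH1`),
  `resH1Hom_mem_unramifiedKer` (`ι_*` preserves `unramifiedKer`), **`forall_conjH1_resH1Hom_mem_unramifiedKer`** (clause (2) of (SUR_U)
  transports along `ι_*`), **`resOfLe_sub_eq_zero_of_level`** (clause (1) transports: with `ι ∘ j = ι₀`, the matching of `conj_{q.out} z`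
  against `j_* τ₀` modulo `U ⊓ I_w` at level `m` gives the matching of `conj_{q.out} (ι_* z)` against `ι₀_* τ₀` in `A'`). All by the
  functoriality `resH1Hom_comp` / `resH1Hom_congr` of the tree.
presearch: Serre, Galois Cohomology I §2 (torsion dévissage); folklore; no new fact. beyond-print theorem: no.

References: [SerreGaloisCohomology1997] I §2.2, I §5; [NeukirchSchmidtWingberg2008] I §5; [GreenbergVatsal2000] §2 p. 17.
-/

noncomputable section

open scoped Classical

set_option linter.dupNamespace false
set_option autoImplicit false

open NumberField IsDedekindDomain Field
open Literature.NumberTheory.EllipticCurves Literature.NumberTheory.EllipticCurves.GreenbergSelmer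
open Literature.NumberTheory.EllipticCurves.GreenbergVatsal2000 Literature.NumberTheory.GaloisRepresentations

namespace Summit.BirchSwinnertonDyer.BirchSwinnertonDyer.Theorems.PrintCf2.LayerShapiro

universe u
variable {G : Type u} [Group G] [TopologicalSpace G] [IsTopologicalGroup G]
variable {M₀ A : Type u} [AddCommGroup M₀] [DistribMulAction G M₀] [TopologicalSpace M₀] [DiscreteTopology M₀]
  [AddCommGroup A] [DistribMulAction G A] [TopologicalSpace A] [DiscreteTopology A]

/-! ## §1. Classes killed by `N` come from the level `A[N]` -/

/-- **Classes killed by `N` come from the level `A[N]` when `A` is `N`-divisible.** `G` a topological group, `A` a discrete `G`-module with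
open stabilisers (`hA`), `ι : M₀ → A` an injective equivariant additive map whose image contains the `N`-torsion (`hrange`), `A`
`N`-divisible (`hdiv`): every `x ∈ H¹(G, A)` with `N • x = 0` is `ι_* y` for some `y ∈ H¹(G, M₀)`. Proof on cocycles: `N • φ = ∂a`,
`a = N • b`, and `φ − ∂b` is an `A[N]`-valued continuous crossed homomorphism. [cite: SerreGaloisCohomology1997, I §2.2] -/
theorem exists_resH1Hom_eq_of_nsmul_eq_zero (hA : ∀ a : A, IsOpen (MulAction.stabilizer G a : Set G))
    (ι : M₀ →+ A) (hι : ∀ (g : G) (m : M₀), ι (g • m) = g • ι m)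
    (hinj : Function.Injective ι) (N : ℕ) (hrange : ∀ a : A, N • a = 0 → ∃ m, ι m = a)
    (hdiv : ∀ a : A, ∃ b : A, N • b = a) (x : discreteH1 G A) (hx : N • x = 0) :
    ∃ y : discreteH1 G M₀, resH1Hom (ContinuousMonoidHom.id G) ι (fun g m ↦ hι g m) y = x := by
  obtain ⟨φ, rfl⟩ := oneCocycleClass_surjective _ x
  -- `N • φ` is a coboundary: `N • φ g = g • a - a`
  have hN : oneCocycleClass (discreteTopRep G A) ((N : ℤ) • φ) = 0 := by
    rw [oneCocycleClass_smul, Nat.cast_smul_eq_nsmul]; exact hx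
  obtain ⟨a, ha⟩ := (oneCocycleClass_eq_zero_iff _ _).1 hN
  obtain ⟨b, hb⟩ := hdiv a
  -- the principal cocycle of `b` and the corrected cocycle `ψ = φ - ∂b`, with values killed by `N`
  obtain ⟨π, hπ⟩ := exists_contOneCocycles_apply_eq_smul_sub (G := G) b (hA b)
  have hψN : ∀ g : G, N • (φ - π).1 g = 0 := fun g ↦ by
    have h := ha g
    change ((N : ℤ) • φ.1) g = g • a - a at h
    rw [ContinuousMap.zsmul_apply, natCast_zsmul] at h
    change N • (φ.1 g - π.1 g) = 0
    rw [hπ, smul_sub, h, smul_sub, ← hb, smul_comm, sub_self]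
  choose m hm using fun g ↦ hrange _ (hψN g)
  -- `ψ₀ : G → M₀` with `ι ∘ ψ₀ = ψ`, continuous and a crossed homomorphism
  have hψ₀cont : Continuous m := by
    refine continuous_discrete_rng.2 fun c ↦ ?_
    have e : m ⁻¹' {c} = (fun g ↦ (φ - π).1 g) ⁻¹' {ι c} := by
      ext g
      simp only [Set.mem_preimage, Set.mem_singleton_iff]
      constructor
      · intro h; rw [← h, hm]
      · intro h; exact hinj ((hm g).trans h)
    rw [e]
    exact (isOpen_discrete _).preimage (φ - π).1.continuous
  let ψ₀ : contOneCocycles (discreteTopRep G M₀) :=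
    ⟨⟨m, hψ₀cont⟩, fun g h ↦ hinj (by
      change ι (m (g * h)) = ι (m g + g • m h)
      rw [map_add, hι, hm, hm, hm]
      exact (φ - π).2 g h)⟩
  refine ⟨oneCocycleClass _ ψ₀, ?_⟩
  have e : resH1Hom (ContinuousMonoidHom.id G) ι (fun g m ↦ hι g m) (oneCocycleClass _ ψ₀) =
      oneCocycleClass _ (contOneCocycles.pullback (ContinuousMonoidHom.id G)
        (resHomOfEquivariant (ContinuousMonoidHom.id G) ι (fun g m ↦ hι g m)) ψ₀) :=
    map_oneCocycleClass _ _ _ ψ₀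
  rw [e]
  have e2 : contOneCocycles.pullback (ContinuousMonoidHom.id G)
      (resHomOfEquivariant (ContinuousMonoidHom.id G) ι (fun g m ↦ hι g m)) ψ₀ = φ - π :=
    Subtype.ext (ContinuousMap.ext fun g ↦ hm g)
  rw [e2, oneCocycleClass_sub, sub_eq_self, oneCocycleClass_eq_zero_iff]
  exact ⟨b, fun g ↦ hπ g⟩


section Transport

variable {K : Type} [Field K] [NumberField K]
variable {N₀ N A' : Type} [AddCommGroup N₀] [DistribMulAction (absoluteGaloisGroup K) N₀] [TopologicalSpace N₀] [DiscreteTopology N₀]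
  [AddCommGroup N] [DistribMulAction (absoluteGaloisGroup K) N] [TopologicalSpace N] [DiscreteTopology N]
  [AddCommGroup A'] [DistribMulAction (absoluteGaloisGroup K) A'] [TopologicalSpace A'] [DiscreteTopology A']
  (U : Subgroup (absoluteGaloisGroup K)) [U.Normal] (w : HeightOneSpectrum (𝓞 K))
  (ι : N →+ A') (hι : ∀ (g : absoluteGaloisGroup K) (m : N), ι (g • m) = g • ι m)

/-! ## §2. Both clauses of (SUR_U) transport along the inclusion of a level -/

omit [NumberField K] in
/-- **`ι_*` commutes with conjugation**: `ι_* (conj_σ z) = conj_σ (ι_* z)` on `H¹(U, ·)` (functoriality of `resH1Hom` in compatible pairs).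
[cite: NeukirchSchmidtWingberg2008, I §5] -/
theorem resH1Hom_conjH1 (σ : absoluteGaloisGroup K) (z : subgroupH1 U N) :
    resH1Hom (ContinuousMonoidHom.id U) ι (fun g m ↦ hι g m) (conjH1 U N σ z) =
      conjH1 U A' σ (resH1Hom (ContinuousMonoidHom.id U) ι (fun g m ↦ hι g m) z) := by
  have hfg : (resH1Hom (ContinuousMonoidHom.id U) ι (fun g m ↦ hι g m)).comp (conjH1 U N σ) =
      (conjH1 U A' σ).comp (resH1Hom (ContinuousMonoidHom.id U) ι (fun g m ↦ hι g m)) := by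
    rw [conjH1, conjH1, resH1Hom_comp, resH1Hom_comp]
    refine resH1Hom_congr ?_ ?_ _ _
    · rfl
    · exact AddMonoidHom.ext fun m ↦ hι σ m
  exact DFunLike.congr_fun hfg z

omit [U.Normal] in
/-- **`ι_*` preserves the unramified condition at `w`**: `c ∈ unramifiedKer U N w ⟹ ι_* c ∈ unramifiedKer U A' w` (restriction to
`U ⊓ I_w` commutes with the change of coefficients). [cite: GreenbergVatsal2000, §2 p. 17] -/
theorem resH1Hom_mem_unramifiedKer {c : subgroupH1 U N} (hc : c ∈ GreenbergVatsal2000.unramifiedKer U N w) :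
    resH1Hom (ContinuousMonoidHom.id U) ι (fun g m ↦ hι g m) c ∈ GreenbergVatsal2000.unramifiedKer U A' w := by
  rw [GreenbergVatsal2000.unramifiedKer, AddMonoidHom.mem_ker] at hc ⊢
  have e : (resH1Hom (inertiaInToH U w) (AddMonoidHom.id A') (fun _ _ ↦ rfl)).comp
      (resH1Hom (ContinuousMonoidHom.id U) ι (fun g m ↦ hι g m)) =
      (resH1Hom (ContinuousMonoidHom.id (inertiaIn U w)) ι (fun g m ↦ hι _ m)).comp
        (resH1Hom (inertiaInToH U w) (AddMonoidHom.id N) (fun _ _ ↦ rfl)) := by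
    rw [resH1Hom_comp, resH1Hom_comp]
    refine resH1Hom_congr ?_ ?_ _ _
    · rfl
    · exact AddMonoidHom.ext fun _ ↦ rfl
  have h := congrArg (fun f ↦ f c) e
  simp only [AddMonoidHom.comp_apply] at h
  rw [h, hc, map_zero]

/-- **Clause (2) of (SUR_U) transports along `ι_*`**: if every conjugate of `z` is unramified at `w`, so is every conjugate of `ι_* z`.
[cite: GreenbergVatsal2000, §2 p. 17] -/
theorem forall_conjH1_resH1Hom_mem_unramifiedKer {z : subgroupH1 U N}
    (hz : ∀ σ : absoluteGaloisGroup K, conjH1 U N σ z ∈ GreenbergVatsal2000.unramifiedKer U N w) (σ : absoluteGaloisGroup K) :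
    conjH1 U A' σ (resH1Hom (ContinuousMonoidHom.id U) ι (fun g m ↦ hι g m) z) ∈ GreenbergVatsal2000.unramifiedKer U A' w := by
  rw [← resH1Hom_conjH1 U ι hι σ z]
  exact resH1Hom_mem_unramifiedKer U w ι hι (hz σ)

/-- **Clause (1) of (SUR_U) transports along `ι_*`**: for equivariant `j : N₀ → N`, `ι : N → A'`, `ι₀ = ι ∘ j : N₀ → A'` and a target
`τ₀ ∈ H¹(U ⊓ D_w, N₀)`: if `res_{U ⊓ D_w}(conj_{q.out} z) − j_* τ₀` dies on `U ⊓ I_w`, so does `res_{U ⊓ D_w}(conj_{q.out} (ι_* z)) − ι₀_* τ₀`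
(the two levels `A[p^k] ↪j A[p^m] ↪ι A`, `ι₀` the lower inclusion). [cite: GreenbergVatsal2000, §2 Prop. 2.1] [cite: NeukirchSchmidtWingberg2008, I §5] -/
theorem resOfLe_sub_eq_zero_of_level (j : N₀ →+ N) (hj : ∀ (g : absoluteGaloisGroup K) (m : N₀), j (g • m) = g • j m)
    (ι₀ : N₀ →+ A') (hι₀ : ∀ (g : absoluteGaloisGroup K) (m : N₀), ι₀ (g • m) = g • ι₀ m) (hcomp : ∀ m, ι (j m) = ι₀ m)
    (q : DoubleCoset.Quotient (decomp (K := K) w : Set (absoluteGaloisGroup K)) (U : Set (absoluteGaloisGroup K)))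
    (z : subgroupH1 U N) (τ₀ : subgroupH1 (decompIn U w) N₀)
    (h : resOfLe N (inertiaIn_le_decompIn U w)
        (resH1Hom (decompInToH U w) (AddMonoidHom.id N) (fun _ _ ↦ rfl) (conjH1 U N q.out z) -
          resH1Hom (ContinuousMonoidHom.id (decompIn U w)) j (fun _ m ↦ hj _ m) τ₀) = 0) :
    resOfLe A' (inertiaIn_le_decompIn U w)
        (resH1Hom (decompInToH U w) (AddMonoidHom.id A') (fun _ _ ↦ rfl)
            (conjH1 U A' q.out (resH1Hom (ContinuousMonoidHom.id U) ι (fun g m ↦ hι g m) z)) -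
          resH1Hom (ContinuousMonoidHom.id (decompIn U w)) ι₀ (fun _ m ↦ hι₀ _ m) τ₀) = 0 := by
  -- `ι_*` at the three groups
  let ιU := resH1Hom (ContinuousMonoidHom.id U) ι (fun g m ↦ hι g m)
  let ιD := resH1Hom (ContinuousMonoidHom.id (decompIn U w)) ι (fun g m ↦ hι _ m)
  let ιI := resH1Hom (ContinuousMonoidHom.id (inertiaIn U w)) ι (fun g m ↦ hι _ m)
  have e1 : resH1Hom (decompInToH U w) (AddMonoidHom.id A') (fun _ _ ↦ rfl) (conjH1 U A' q.out (ιU z)) =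
      ιD (resH1Hom (decompInToH U w) (AddMonoidHom.id N) (fun _ _ ↦ rfl) (conjH1 U N q.out z)) := by
    rw [← resH1Hom_conjH1 U ι hι]
    have hfg : (resH1Hom (decompInToH U w) (AddMonoidHom.id A') (fun _ _ ↦ rfl)).comp ιU =
        ιD.comp (resH1Hom (decompInToH U w) (AddMonoidHom.id N) (fun _ _ ↦ rfl)) := by
      simp only [ιU, ιD]
      rw [resH1Hom_comp, resH1Hom_comp]
      refine resH1Hom_congr ?_ ?_ _ _
      · rfl
      · exact AddMonoidHom.ext fun _ ↦ rfl
    exact DFunLike.congr_fun hfg _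
  have e2 : resH1Hom (ContinuousMonoidHom.id (decompIn U w)) ι₀ (fun _ m ↦ hι₀ _ m) τ₀ =
      ιD (resH1Hom (ContinuousMonoidHom.id (decompIn U w)) j (fun _ m ↦ hj _ m) τ₀) := by
    have hfg : resH1Hom (ContinuousMonoidHom.id (decompIn U w)) ι₀ (fun _ m ↦ hι₀ _ m) =
        ιD.comp (resH1Hom (ContinuousMonoidHom.id (decompIn U w)) j (fun _ m ↦ hj _ m)) := by
      simp only [ιD]
      rw [resH1Hom_comp]
      refine resH1Hom_congr ?_ ?_ _ _
      · rfl
      · exact AddMonoidHom.ext fun m ↦ (hcomp m).symm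
    exact DFunLike.congr_fun hfg τ₀
  have e3 : ∀ y, resOfLe A' (inertiaIn_le_decompIn U w) (ιD y) = ιI (resOfLe N (inertiaIn_le_decompIn U w) y) := fun y ↦ by
    have hfg : (resOfLe A' (inertiaIn_le_decompIn U w)).comp ιD = ιI.comp (resOfLe N (inertiaIn_le_decompIn U w)) := by
      simp only [ιD, ιI, resOfLe]
      rw [resH1Hom_comp, resH1Hom_comp]
      refine resH1Hom_congr ?_ ?_ _ _
      · rfl
      · exact AddMonoidHom.ext fun _ ↦ rfl
    exact DFunLike.congr_fun hfg y
  rw [e1, e2, ← map_sub, e3, h, map_zero]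

end Transport

end Summit.BirchSwinnertonDyer.BirchSwinnertonDyer.Theorems.PrintCf2.LayerShapiro

end
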